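import Mathlib
import Summits.Ventures.PercRepro2.Defs
import Summits.Ventures.PercRepro2.Independence
import Summits.Ventures.PercRepro2.Harris
import Summits.Ventures.PercRepro2.Graph
import Summits.Ventures.PercRepro2.Exploration
import Summits.Ventures.PercRepro2.Events
import Summits.Ventures.PercRepro2.Induced
import Summits.Ventures.PercRepro2.BHK
import Summits.Ventures.PercRepro2.BHKEvents
import Summits.Ventures.PercRepro2.OneEdge
import Summits.Ventures.PercRepro2.RBRoot
import Summits.Ventures.PercRepro2.RBRootEdge
import Summits.Ventures.PercRepro2.RBRootEdgePin
import Summits.Ventures.PercRepro2.RBRootEdgeMain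
import Summits.Ventures.PercRepro2.RBRootIsolated
import Summits.Ventures.PercRepro2.RBTwoMarkers

/-!
# Row 2′RB at a third vertex adjacent only to the two markers — same form, II (mine-a g5; §32)

The theorem `same_two_markers_of_zero`: with `e₁ = {w, b}`, `e₂ = {w, o}` the only edges of
nonzero weight at `w` and `w ∉ {s, t, b, o}`, the same form of the row holds at `w`
(`same_two_markers`: the case in which they are the only edges at `w`). Ingredients from
`RBTwoMarkers`: the weight-free leaf invariance `prob_leaf_update_events`, the marker-edge
affinity `rbSum_pin_same_marker`, the collapse `rbSum_update_one_marker`, the algebraic `mix_var`;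
from `RBRootIsolated`: the isolated bottom; from `RBRoot`: BHK 1.3 on `G − w` (`same_collapsed`).
-/

namespace Summit.Ventures.PercRepro2

namespace RBTwoMarkers

open scoped Classical

section Main

variable {V : Type*} {E : Type*} [Fintype E] [DecidableEq E] [Fintype V] {R : Type*} [Field R]
  [LinearOrder R] [IsStrictOrderedRing R] (ends : E → Sym2 V) (s t w : V)

omit [Fintype V] [LinearOrder R] [IsStrictOrderedRing R] in
/-- **Leaf invariance of the masses**: with `p e₂ = 0` pinned, forcing `e₁` (open or closed)
does not change `P(S)` for the four events of the same form. -/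
lemma prob_leaf_update {p : E → R} {e₁ e₂ : E} {b o : V} (H : ∀ e, w ∈ ends e → e = e₁ ∨ e = e₂)
    (hends : ends e₁ = s(w, b)) (hws : s ≠ w) (hwt : t ≠ w) (hwb : b ≠ w) (hwo : o ≠ w) (c : R)
    (hc : c = 0 ∨ c = 1) :
    prob (Function.update (Function.update p e₂ 0) e₁ c) (connEvent ends s t)ᶜ =
        prob (Function.update p e₂ 0) (connEvent ends s t)ᶜ ∧
      prob (Function.update (Function.update p e₂ 0) e₁ c) ((connEvent ends s t)ᶜ ∩ connEvent ends b s) =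
        prob (Function.update p e₂ 0) ((connEvent ends s t)ᶜ ∩ connEvent ends b s) ∧
      prob (Function.update (Function.update p e₂ 0) e₁ c) ((connEvent ends s t)ᶜ ∩ connEvent ends o s) =
        prob (Function.update p e₂ 0) ((connEvent ends s t)ᶜ ∩ connEvent ends o s) ∧
      prob (Function.update (Function.update p e₂ 0) e₁ c)
          ((connEvent ends s t)ᶜ ∩ connEvent ends b s ∩ connEvent ends o s) =
        prob (Function.update p e₂ 0) ((connEvent ends s t)ᶜ ∩ connEvent ends b s ∩ connEvent ends o s) := by
  have hz : ∀ e, w ∈ ends e ∧ e ≠ e₁ → Function.update p e₂ 0 e = 0 := by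
    rintro e ⟨he, hne⟩
    rcases H e he with rfl | rfl
    · exact absurd rfl hne
    · exact Function.update_self _ _ _
  obtain ⟨h1, h2, h3, -, h4, -⟩ :=
    prob_leaf_update_events ends w (Function.update p e₂ 0) hz hends s t b o hws hwt hwb hwo c hc
  exact ⟨h1, h2, h3, h4⟩

omit [Fintype V] [LinearOrder R] [IsStrictOrderedRing R] in
/-- Under `p[e₂ ↦ 1][e₁ ↦ 1]` (`e₁ = {w, b}`, `e₂ = {w, o}`) the events `Q ∩ bL`, `Q ∩ oL`,
`Q ∩ bL ∩ oL` have the same probability (`b, o ∈ C(w)` and `bL = oL = {s ∈ C(w)}`). -/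
lemma prob_both_open (p : E → R) {e₁ e₂ : E} {b o : V} (hends₁ : ends e₁ = s(w, b))
    (hends₂ : ends e₂ = s(w, o)) (hne : e₁ ≠ e₂) :
    prob (Function.update (Function.update p e₂ 1) e₁ 1) ((connEvent ends s t)ᶜ ∩ connEvent ends b s) =
        prob (Function.update (Function.update p e₂ 1) e₁ 1)
          ((connEvent ends s t)ᶜ ∩ connEvent ends b s ∩ connEvent ends o s) ∧
      prob (Function.update (Function.update p e₂ 1) e₁ 1) ((connEvent ends s t)ᶜ ∩ connEvent ends o s) =
        prob (Function.update (Function.update p e₂ 1) e₁ 1)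
          ((connEvent ends s t)ᶜ ∩ connEvent ends b s ∩ connEvent ends o s) := by
  -- both edges are open almost surely
  have h2 : ∀ S : Set (Config E), prob (Function.update (Function.update p e₂ 1) e₁ 1) S =
      prob (Function.update (Function.update p e₂ 1) e₁ 1) (S ∩ openEdge e₂ ∩ openEdge e₁) := by
    intro S
    rw [prob_update_one_inter_openEdge (Function.update p e₂ 1) (S ∩ openEdge e₂) e₁,
      Function.update_comm hne.symm, prob_update_one_inter_openEdge (Function.update p e₁ 1) S e₂]
  have hbo : ∀ ω : Config E, ω e₁ = true → ω e₂ = true →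
      (Conn ends ω b s ↔ Conn ends ω o s) := by
    intro ω h1 h2'
    have hbw : Conn ends ω b w := conn_symm (conn_of_openAdj ⟨e₁, h1, hends₁⟩)
    have how : Conn ends ω o w := conn_symm (conn_of_openAdj ⟨e₂, h2', hends₂⟩)
    exact ⟨fun h => conn_trans how (conn_trans (conn_symm hbw) h),
      fun h => conn_trans hbw (conn_trans (conn_symm how) h)⟩
  constructor
  · rw [h2, h2 ((connEvent ends s t)ᶜ ∩ connEvent ends b s ∩ connEvent ends o s)]
    congr 1
    ext ω
    simp only [Set.mem_inter_iff, mem_openEdge, mem_connEvent]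
    constructor
    · rintro ⟨⟨⟨hQ, hb⟩, h2'⟩, h1⟩; exact ⟨⟨⟨⟨hQ, hb⟩, (hbo ω h1 h2').1 hb⟩, h2'⟩, h1⟩
    · rintro ⟨⟨⟨⟨hQ, hb⟩, _⟩, h2'⟩, h1⟩; exact ⟨⟨⟨hQ, hb⟩, h2'⟩, h1⟩
  · rw [h2, h2 ((connEvent ends s t)ᶜ ∩ connEvent ends b s ∩ connEvent ends o s)]
    congr 1
    ext ω
    simp only [Set.mem_inter_iff, mem_openEdge, mem_connEvent]
    constructor
    · rintro ⟨⟨⟨hQ, ho'⟩, h2'⟩, h1⟩; exact ⟨⟨⟨⟨hQ, (hbo ω h1 h2').2 ho'⟩, ho'⟩, h2'⟩, h1⟩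
    · rintro ⟨⟨⟨⟨hQ, _⟩, ho'⟩, h2'⟩, h1⟩; exact ⟨⟨⟨hQ, ho'⟩, h2'⟩, h1⟩

/-- **Row 2′RB, same form, at a third vertex adjacent only to the two markers** (`e₁ = {w, b}`,
`e₂ = {w, o}` the only edges of nonzero weight at `w`, `w ∉ {s, t, b, o}`). -/
theorem same_two_markers_of_zero {p : E → R} (hp : IsProbVec p) {e₁ e₂ : E} {b o : V}
    (hz : ∀ e, w ∈ ends e → e ≠ e₁ → e ≠ e₂ → p e = 0) (hends₁ : ends e₁ = s(w, b))
    (hends₂ : ends e₂ = s(w, o)) (hne : e₁ ≠ e₂) (hws : s ≠ w) (hwt : t ≠ w) (hwb : b ≠ w)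
    (hwo : o ≠ w) :
    prob p ((connEvent ends s t)ᶜ ∩ connEvent ends b s) *
        prob p ((connEvent ends s t)ᶜ ∩ connEvent ends o s) / prob p (connEvent ends s t)ᶜ ≤
      RBRoot.rbSum p ends s t w (connEvent ends b s) (connEvent ends o s) := by
  have hz₂ : ∀ e, w ∈ ends e ∧ e ≠ e₁ → Function.update p e₂ 0 e = 0 := by
    rintro e ⟨he, hne₁⟩
    by_cases h : e = e₂
    · subst h; exact Function.update_self _ _ _
    · rw [Function.update_of_ne h]; exact hz e he hne₁ h
  have hz₁ : ∀ e, w ∈ ends e ∧ e ≠ e₂ → Function.update p e₁ 0 e = 0 := by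
    rintro e ⟨he, hne₂⟩
    by_cases h : e = e₁
    · subst h; exact Function.update_self _ _ _
    · rw [Function.update_of_ne h]; exact hz e he h hne₂
  have hp21 : IsProbVec (Function.update p e₂ 1) := hp.update e₂ zero_le_one le_rfl
  have hp20 : IsProbVec (Function.update p e₂ 0) := hp.update e₂ le_rfl zero_le_one
  have hβ21 : Function.update p e₂ 1 e₁ = p e₁ := Function.update_of_ne hne _ _
  have hβ20 : Function.update p e₂ 0 e₁ = p e₁ := Function.update_of_ne hne _ _
  -- leaf invariances
  obtain ⟨L1a, L1b, L1c, -, L1d, -⟩ := prob_leaf_update_events ends w (Function.update p e₂ 0) hz₂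
    hends₁ s t b o hws hwt hwb hwo 1 (Or.inr rfl)
  obtain ⟨L0a, L0b, L0c, -, L0d, -⟩ := prob_leaf_update_events ends w (Function.update p e₂ 0) hz₂
    hends₁ s t b o hws hwt hwb hwo 0 (Or.inl rfl)
  obtain ⟨L01a, L01b, L01c, -, L01d, -⟩ := prob_leaf_update_events ends w (Function.update p e₁ 0)
    hz₁ hends₂ s t b o hws hwt hwb hwo 1 (Or.inr rfl)
  obtain ⟨L00a, L00b, L00c, -, L00d, -⟩ := prob_leaf_update_events ends w (Function.update p e₁ 0)
    hz₁ hends₂ s t b o hws hwt hwb hwo 0 (Or.inl rfl)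
  rw [Function.update_comm hne] at L01a L01b L01c L01d L00a L00b L00c L00d
  obtain ⟨hMb, hMo⟩ := prob_both_open ends s t w p hends₁ hends₂ hne
  -- the masses on `G − w` (weights `p[e₂ ↦ 0]`) and under both edges open
  set A := prob (Function.update p e₂ 0) ((connEvent ends s t)ᶜ ∩ connEvent ends b s) with hA
  set C := prob (Function.update p e₂ 0) ((connEvent ends s t)ᶜ ∩ connEvent ends o s) with hC
  set Z := prob (Function.update p e₂ 0) (connEvent ends s t)ᶜ with hZ
  set J := prob (Function.update p e₂ 0) ((connEvent ends s t)ᶜ ∩ connEvent ends b s ∩ connEvent ends o s)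
    with hJ
  set M := prob (Function.update (Function.update p e₂ 1) e₁ 1)
    ((connEvent ends s t)ᶜ ∩ connEvent ends b s ∩ connEvent ends o s) with hM
  set Z₁ := prob (Function.update (Function.update p e₂ 1) e₁ 1) (connEvent ends s t)ᶜ with hZ₁
  -- `p[e₂↦1][e₁↦0]` sees `G − w`
  have E01 : prob (Function.update (Function.update p e₂ 1) e₁ 0) (connEvent ends s t)ᶜ = Z ∧
      prob (Function.update (Function.update p e₂ 1) e₁ 0) ((connEvent ends s t)ᶜ ∩ connEvent ends b s) = A ∧
      prob (Function.update (Function.update p e₂ 1) e₁ 0) ((connEvent ends s t)ᶜ ∩ connEvent ends o s) = C ∧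
      prob (Function.update (Function.update p e₂ 1) e₁ 0)
        ((connEvent ends s t)ᶜ ∩ connEvent ends b s ∩ connEvent ends o s) = J := by
    refine ⟨?_, ?_, ?_, ?_⟩
    · rw [L01a, ← L00a, L0a]
    · rw [L01b, ← L00b, L0b]
    · rw [L01c, ← L00c, L0c]
    · rw [L01d, ← L00d, L0d]
  -- (a) the masses under `p`
  have hPb : prob p ((connEvent ends s t)ᶜ ∩ connEvent ends b s) =
      p e₂ * p e₁ * M + (1 - p e₂ * p e₁) * A := by
    rw [prob_eq_pin p _ e₂, prob_eq_pin (Function.update p e₂ 1) _ e₁, hβ21, hMb, E01.2.1,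
      prob_eq_pin (Function.update p e₂ 0) _ e₁, hβ20, L1b, L0b]
    ring
  have hPo : prob p ((connEvent ends s t)ᶜ ∩ connEvent ends o s) =
      p e₂ * p e₁ * M + (1 - p e₂ * p e₁) * C := by
    rw [prob_eq_pin p _ e₂, prob_eq_pin (Function.update p e₂ 1) _ e₁, hβ21, hMo, E01.2.2.1,
      prob_eq_pin (Function.update p e₂ 0) _ e₁, hβ20, L1c, L0c]
    ring
  have hPQ : prob p (connEvent ends s t)ᶜ = p e₂ * p e₁ * Z₁ + (1 - p e₂ * p e₁) * Z := by
    rw [prob_eq_pin p _ e₂, prob_eq_pin (Function.update p e₂ 1) _ e₁, hβ21, E01.1, ← hZ₁,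
      prob_eq_pin (Function.update p e₂ 0) _ e₁, hβ20, L1a, L0a]
    ring
  -- (b) the Rao–Blackwell sum: `e₂` open collapses at `o`; `e₂` closed, `e₁` open collapses at
  -- `b`; both closed is the isolated case
  have hS1 : RBRoot.rbSum (Function.update p e₂ 1) ends s t w (connEvent ends b s) (connEvent ends o s) =
      p e₁ * M + (1 - p e₁) * J := by
    rw [RBRoot.rbSum_comm, rbSum_update_one_marker ends s t w p hp hends₂ b, RBRoot.inter_inter_comm,
      prob_eq_pin (Function.update p e₂ 1) _ e₁, hβ21, E01.2.2.2]
  have hS10 : RBRoot.rbSum (Function.update (Function.update p e₂ 0) e₁ 1) ends s t w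
      (connEvent ends b s) (connEvent ends o s) = J := by
    rw [rbSum_update_one_marker ends s t w (Function.update p e₂ 0) hp20 hends₁ o, L1d]
  have hiso : ∀ e, w ∈ ends e → Function.update (Function.update p e₂ 0) e₁ 0 e = 0 := by
    intro e he
    by_cases h₁ : e = e₁
    · subst h₁; simp
    · rw [Function.update_of_ne h₁]; exact hz₂ e ⟨he, h₁⟩
  have hS00 : RBRoot.rbSum (Function.update (Function.update p e₂ 0) e₁ 0) ends s t w
      (connEvent ends b s) (connEvent ends o s) = A * C / Z := by
    rw [RBRoot.rbSum_isolated _ ends w hiso s t, L0a, L0b, L0c]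
  have hS : RBRoot.rbSum p ends s t w (connEvent ends b s) (connEvent ends o s) =
      p e₂ * (p e₁ * M + (1 - p e₁) * J) + (1 - p e₂) * (p e₁ * J + (1 - p e₁) * (A * C / Z)) := by
    rw [RBRoot.rbSum_comm, rbSum_pin_same_marker ends s t w hp hends₂ b,
      RBRoot.rbSum_comm (Function.update p e₂ 1) ends s t w,
      RBRoot.rbSum_comm (Function.update p e₂ 0) ends s t w, hS1,
      rbSum_pin_same_marker ends s t w hp20 hends₁ o, hβ20, hS10, hS00]
  -- (c) BHK 1.3 on `G − w` and the mixture inequality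
  have hBHK : A * C / Z ≤ J := RBRoot.same_collapsed ends hp20 o b s t
  have hx0 : 0 ≤ p e₂ * p e₁ := mul_nonneg (hp.nonneg e₂) (hp.nonneg e₁)
  have hx1 : p e₂ * p e₁ ≤ 1 := mul_le_one₀ (hp.le_one e₂) (hp.nonneg e₁) (hp.le_one e₁)
  have hp11 : IsProbVec (Function.update (Function.update p e₂ 1) e₁ 1) :=
    hp21.update e₁ zero_le_one le_rfl
  have hM0 : 0 ≤ M := prob_nonneg hp11 _
  have hMZ : M ≤ Z₁ := prob_mono hp11 (Set.inter_subset_left.trans Set.inter_subset_left)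
  have hA0 : 0 ≤ A := prob_nonneg hp20 _
  have hAZ : A ≤ Z := prob_mono hp20 Set.inter_subset_left
  have hC0 : 0 ≤ C := prob_nonneg hp20 _
  have hCZ : C ≤ Z := prob_mono hp20 Set.inter_subset_left
  have hmix := mix_var (x := p e₂ * p e₁) (M := M) (Z₁ := Z₁) (A := A) (C := C) (Z := Z) hx0 hx1
    hM0 hMZ hA0 hAZ hC0 hCZ
  rw [hPb, hPo, hPQ, hS]
  refine hmix.trans ?_
  have hcoef : 0 ≤ p e₂ * (1 - p e₁) + (1 - p e₂) * p e₁ :=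
    add_nonneg (mul_nonneg (hp.nonneg e₂) (sub_nonneg.2 (hp.le_one e₁)))
      (mul_nonneg (sub_nonneg.2 (hp.le_one e₂)) (hp.nonneg e₁))
  have hpos := mul_nonneg hcoef (sub_nonneg.2 hBHK)
  have key : p e₂ * (p e₁ * M + (1 - p e₁) * J) + (1 - p e₂) * (p e₁ * J + (1 - p e₁) * (A * C / Z)) -
      (p e₂ * p e₁ * M + (1 - p e₂ * p e₁) * (A * C / Z)) =
      (p e₂ * (1 - p e₁) + (1 - p e₂) * p e₁) * (J - A * C / Z) := by ring
  linarith [key, hpos]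


/-- **Row 2′RB, same form, at a third vertex whose only edges are the two marker edges**
(MINE-A.md §32, same form): the special case of `same_two_markers_of_zero` in which `e₁`, `e₂`
are the only edges at `w`. -/
theorem same_two_markers {p : E → R} (hp : IsProbVec p) {e₁ e₂ : E} {b o : V}
    (H : ∀ e, w ∈ ends e → e = e₁ ∨ e = e₂) (hends₁ : ends e₁ = s(w, b))
    (hends₂ : ends e₂ = s(w, o)) (hne : e₁ ≠ e₂) (hws : s ≠ w) (hwt : t ≠ w) (hwb : b ≠ w)
    (hwo : o ≠ w) :
    prob p ((connEvent ends s t)ᶜ ∩ connEvent ends b s) *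
        prob p ((connEvent ends s t)ᶜ ∩ connEvent ends o s) / prob p (connEvent ends s t)ᶜ ≤
      RBRoot.rbSum p ends s t w (connEvent ends b s) (connEvent ends o s) :=
  same_two_markers_of_zero ends s t w hp (fun e he hne₁ hne₂ => by
    rcases H e he with rfl | rfl
    · exact absurd rfl hne₁
    · exact absurd rfl hne₂) hends₁ hends₂ hne hws hwt hwb hwo

end Main

end RBTwoMarkers

end Summit.Ventures.PercRepro2
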